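import Summits.QuantumFields.BalabanUV.Beta.SecondOrderContactMmRead

/-!
# `BalabanUV.Beta.SecondOrderStepLaw` — binder row D1, (L4) piece (W-E) EVALUATION, part 3b: **THE LEVEL STEP, ASSEMBLED** — the
# reflection law of a next-level second-order table `T := a • Q + b • B` (field–field sector `Q` read through `mmRead`, border sector `B`)
# in an5's `conjW` form against a bordered `𝕄`, from the EVALUATED law of `Q` (part 3a), the border letter of `B`, and the units locks;
# the new remainder is DISPLAYED (β sub-cell, row BETA-an2 = BINDER-OWNERS row D1 OWNER, lineage an2 gen 18)

HONEST FRAMING (cell charter, verbatim): «discharging BetaPertH makes Balaban's UV stability UNCONDITIONAL — a real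
constructive-QFT result; it is NOT the continuum limit and NOT the Clay problem.»  Neutral kernel algebra ([folklore]), entrywise by fibre
blocks (the order-2 twin of an2's `StepReflectionRec.cubicStep_bref_of_ffLaw`); no statement of Bałaban's papers, no `[cite:]`, no `def`,
no `Prop` fact; instantiates no binder of the wall.  NOT D1, NOT `BetaPertH`, NOT continuum, NOT Clay.

## The theorem `quarticStep_bref_of_laws` (all objects abstract; `N` = the blocking of the `mm`-read, `L` = the blocking of the generator)

DATA at the next level: a kernel `𝕄` whose field–field block is `w ·` that of `mmRead N G` (`hff`; `w ≠ 0`); a field–field sector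
`Q := κuκ′u′ ↦ mmRead N (Q₀ κ u κ′ u′)`, first-order field letters `E κ u := mmRead N (E₀ κ u)` and a transported remainder `mmRead N (R₀ …)`
(all living on the field block by construction); a border sector `B` VANISHING on the field block (`hBff`); border first-order letters `Vbd`
vanishing on the field block (`hVff`); the first-order letters of the next level `V κ u := aE • E κ u + Vbd κ u`; generator symbols
`κ₁ · ctGen d α L κ u` (the COARSE symbol delivered by part 3a) and `γ′ · ctGen d α L κ u` (the next level's), second symbols `ĥ` (transported)
and `hB` (the border letter's).
HYPOTHESES: (hQ) the EVALUATED law of `Q` — `Q κ (bref u) κ′ (bref u′) = (ε ε) • refK (Q κuκ′u′ + conjW (mmRead N G) (E κu) (E κ′u′) (diagK (κ₁·ctGen κu))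
(diagK (κ₁·ctGen κ′u′)) (diagK (ĥ κuκ′u′)) − mmRead N (R₀ κuκ′u′))` (the shape of `SecondOrderStepEval.mmRead_K3OfK_stepProp_bref`);
(hBfm/hBmf/hBmm) THE BORDER LETTER, per border block, against the FULL `𝕄` and the FULL first-order letters:
`(b • B κ (bref u) κ′ (bref u′)) x z (inl β) (inr m) = ((ε ε) • refK (b • B κuκ′u′ + conjW 𝕄 (V κu) (V κ′u′) (diagK (γ′·ctGen κu)) (diagK (γ′·ctGen κ′u′)) (diagK (hB κuκ′u′)) + RB κuκ′u′)) x z (inl β) (inr m)`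
(and the two other border blocks), with `RB` vanishing on the field block (`hRBff`); THE LOCKS in solved form `γ′ = aE·κ₁/w`, `a = aE²/w`.
CONCLUSION: for `T κ u κ′ u′ := a • Q κ u κ′ u′ + b • B κ u κ′ u′`,
`T κ (bref u) κ′ (bref u′) = (ε ε) • refK (T κuκ′u′ + conjW 𝕄 (V κu) (V κ′u′) (diagK (γ′·ctGen κu)) (diagK (γ′·ctGen κ′u′)) (diagK (hB κuκ′u′)) + R κuκ′u′)`
with the DISPLAYED remainder **`R := −a • mmRead N R₀ + RB + conjV (mmRead N G) (diagK (a·ĥ − w·hB))`** — the transported remainder, the border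
letter's remainder, and ONE COMMUTATOR with the field block absorbing the mismatch of the two second symbols (row D1 memo v2: a commutator of the
parity-even field block with a diagonal kernel is row-parity-odd, hence tadpole-null against `G_{j+1}` — the hereditary remainder class).
READING (wall, level `j → j+1`): `𝕄 = bhKStepAt 3 ρ_c Lc (j+1)`, `G = G_j`, `w = wVH (j+1)` (`SpineRecursiveClosed.mmRead_stepProp_eq_inv_wVH_mul`),
`Q₀ = K3OfK G_j Lc (SpureRecAt j) (M1At j) (WrecAt j)`, `a = cE₂·wV4 (j+1)`, `E₀ = K2OfK G_j …` (`= e3OfK`, (c1)), `aE = cE·wE (j+1)`,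
`Vbd = (cVH·wVH (j+1)) • vhSAt ρ_c`, `B = vh₂S`, `b = cB·wB2 (j+1)`, `κ₁ = γ_j/(stepScale j·Lc⁴)`, `γ′ = γ_{j+1}`; the locks read `γ_{j+1} = cE·wE (j+1)·κ₁/wVH (j+1)`
(= `SpineRecursiveInductive`'s `hlock`) and **`cE₂·wV4 (j+1)·wVH (j+1) = (cE·wE (j+1))²`** (the ONE second-order lock; `cE₂ = cE²` at the tree's
weights, `= Lc⁸` at the pin).  NOT HERE: the border letter itself ((W-0B), an1), the parity/localisation of `R`, the induction.
Provenance: β sub-cell, unit beta-an2 gen 18, 2026-08-20 (v1); no existing file touched.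
-/

open Finset
open scoped BigOperators
open Literature.MathematicalPhysics.QuantumFieldTheory.Balaban1983to89
open Literature.MathematicalPhysics.QuantumFieldTheory.Balaban1983to89.Beta
open ExpKernelCalculus (MKer)
open PolarizationSign (reflSign)
open KernelReflection (refK refK_apply)
open ResolventReflection (bref Φ)
open OneStepResolventKernel (Fib)
open BalabanStepJetsSucc (mmRead mmRead_inr_left mmRead_inr_right)
open Summit.QuantumFields.BalabanUV.Beta.ChartConjugation (conjV conjW conjW₁ conjW₂)
open Summit.QuantumFields.BalabanUV.Beta.BorderedHessian (diagK ctGen conjV_diagK_apply)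
open Summit.QuantumFields.BalabanUV.Beta.SecondOrderContactForm (conjW₁_diag_apply conjW₂_diag_apply)

namespace Summit.QuantumFields.BalabanUV.Beta.SecondOrderStepLaw

noncomputable section

variable {d : ℕ}

/-- [folklore] **THE SECOND-ORDER CONTACT WITH DIAGONAL GENERATORS IS AN ENTRYWISE MULTIPLIER**:
`conjW 𝕄 V V′ (diagK g) (diagK g′) (diagK h) x z a b = V′·(g z b − g x a) + V·(g′ z b − g′ x a) + 𝕄·(2·g(x,a)·g′(x,a) − (g(x,a)·g′(z,b) + g′(x,a)·g(z,b)) + (h z b − h x a))`. -/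
theorem conjW_diag_apply (M V Vp : MKer (d + 1) (Fib d)) (g g' h : (Fin (d + 1) → ℤ) → Fib d → ℝ) (x z : Fin (d + 1) → ℤ) (a b : Fib d) :
    conjW M V Vp (diagK g) (diagK g') (diagK h) x z a b =
      Vp x z a b * (g z b - g x a) + V x z a b * (g' z b - g' x a) +
        M x z a b * (2 * (g x a * g' x a) - (g x a * g' z b + g' x a * g z b) + (h z b - h x a)) := by
  unfold ChartConjugation.conjW
  rw [Pi.add_apply, Pi.add_apply, Pi.add_apply, Pi.add_apply, conjW₁_diag_apply, conjW₂_diag_apply]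

section Step

variable {N L : ℕ} {𝕄 G : MKer (d + 1) (Fib d)} {w a aE b κ₁ γ' : ℝ} {α : Fin (d + 1)}
  {Q₀ R₀ B RB : Fin (d + 1) → (Fin (d + 1) → ℤ) → Fin (d + 1) → (Fin (d + 1) → ℤ) → MKer (d + 1) (Fib d)}
  {E₀ Vbd : Fin (d + 1) → (Fin (d + 1) → ℤ) → MKer (d + 1) (Fib d)}
  {hh hB : Fin (d + 1) → (Fin (d + 1) → ℤ) → Fin (d + 1) → (Fin (d + 1) → ℤ) → (Fin (d + 1) → ℤ) → Fib d → ℝ}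

/-- [folklore] **THE LEVEL STEP, ASSEMBLED** (see the module docstring for the reading of every letter). -/
theorem quarticStep_bref_of_laws (hw : w ≠ 0) (hγ' : γ' = aE * κ₁ / w) (ha : a = aE ^ 2 / w)
    (hff : ∀ (x z : Fin (d + 1) → ℤ) (β β' : Fin (d + 1)), 𝕄 x z (Sum.inl β) (Sum.inl β') = w * mmRead N G x z (Sum.inl β) (Sum.inl β'))
    (hBff : ∀ κ u κ' u' (x z : Fin (d + 1) → ℤ) (β β' : Fin (d + 1)), B κ u κ' u' x z (Sum.inl β) (Sum.inl β') = 0)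
    (hRBff : ∀ κ u κ' u' (x z : Fin (d + 1) → ℤ) (β β' : Fin (d + 1)), RB κ u κ' u' x z (Sum.inl β) (Sum.inl β') = 0)
    (hVff : ∀ κ u (x z : Fin (d + 1) → ℤ) (β β' : Fin (d + 1)), Vbd κ u x z (Sum.inl β) (Sum.inl β') = 0)
    (hQ : ∀ κ u κ' u', mmRead N (Q₀ κ (bref α κ u) κ' (bref α κ' u')) = (reflSign α κ * reflSign α κ') • refK (Φ (d := d) L α)
      (mmRead N (Q₀ κ u κ' u') +
        conjW (mmRead N G) (mmRead N (E₀ κ u)) (mmRead N (E₀ κ' u')) (diagK fun p c => κ₁ * ctGen d α L κ u p c)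
          (diagK fun p c => κ₁ * ctGen d α L κ' u' p c) (diagK (hh κ u κ' u')) - mmRead N (R₀ κ u κ' u')))
    (hBfm : ∀ κ u κ' u' (x z : Fin (d + 1) → ℤ) (β m : Fin (d + 1)),
      (b • B κ (bref α κ u) κ' (bref α κ' u')) x z (Sum.inl β) (Sum.inr m) =
        ((reflSign α κ * reflSign α κ') • refK (Φ (d := d) L α) (b • B κ u κ' u' +
          conjW 𝕄 (aE • mmRead N (E₀ κ u) + Vbd κ u) (aE • mmRead N (E₀ κ' u') + Vbd κ' u') (diagK fun p c => γ' * ctGen d α L κ u p c)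
            (diagK fun p c => γ' * ctGen d α L κ' u' p c) (diagK (hB κ u κ' u')) + RB κ u κ' u')) x z (Sum.inl β) (Sum.inr m))
    (hBmf : ∀ κ u κ' u' (x z : Fin (d + 1) → ℤ) (m β : Fin (d + 1)),
      (b • B κ (bref α κ u) κ' (bref α κ' u')) x z (Sum.inr m) (Sum.inl β) =
        ((reflSign α κ * reflSign α κ') • refK (Φ (d := d) L α) (b • B κ u κ' u' +
          conjW 𝕄 (aE • mmRead N (E₀ κ u) + Vbd κ u) (aE • mmRead N (E₀ κ' u') + Vbd κ' u') (diagK fun p c => γ' * ctGen d α L κ u p c)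
            (diagK fun p c => γ' * ctGen d α L κ' u' p c) (diagK (hB κ u κ' u')) + RB κ u κ' u')) x z (Sum.inr m) (Sum.inl β))
    (hBmm : ∀ κ u κ' u' (x z : Fin (d + 1) → ℤ) (m m' : Fin (d + 1)),
      (b • B κ (bref α κ u) κ' (bref α κ' u')) x z (Sum.inr m) (Sum.inr m') =
        ((reflSign α κ * reflSign α κ') • refK (Φ (d := d) L α) (b • B κ u κ' u' +
          conjW 𝕄 (aE • mmRead N (E₀ κ u) + Vbd κ u) (aE • mmRead N (E₀ κ' u') + Vbd κ' u') (diagK fun p c => γ' * ctGen d α L κ u p c)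
            (diagK fun p c => γ' * ctGen d α L κ' u' p c) (diagK (hB κ u κ' u')) + RB κ u κ' u')) x z (Sum.inr m) (Sum.inr m'))
    (κ : Fin (d + 1)) (u : Fin (d + 1) → ℤ) (κ' : Fin (d + 1)) (u' : Fin (d + 1) → ℤ) :
    a • mmRead N (Q₀ κ (bref α κ u) κ' (bref α κ' u')) + b • B κ (bref α κ u) κ' (bref α κ' u') =
      (reflSign α κ * reflSign α κ') • refK (Φ (d := d) L α)
        ((a • mmRead N (Q₀ κ u κ' u') + b • B κ u κ' u') +
          conjW 𝕄 (aE • mmRead N (E₀ κ u) + Vbd κ u) (aE • mmRead N (E₀ κ' u') + Vbd κ' u') (diagK fun p c => γ' * ctGen d α L κ u p c)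
            (diagK fun p c => γ' * ctGen d α L κ' u' p c) (diagK (hB κ u κ' u')) +
          (-(a • mmRead N (R₀ κ u κ' u')) + RB κ u κ' u' +
            conjV (mmRead N G) (diagK fun p c => a * hh κ u κ' u' p c - w * hB κ u κ' u' p c))) := by
  subst hγ' ha
  funext x z e f
  rcases e with β | m <;> rcases f with β' | m'
  · -- field–field: the `Q` sector carries the contact; the border sector, `Vbd` and `RB` vanish; the locks match the coefficients
    have hq := congrFun (congrFun (congrFun (congrFun (hQ κ u κ' u') x) z) (Sum.inl β)) (Sum.inl β')
    simp only [Pi.add_apply, Pi.sub_apply, Pi.neg_apply, Pi.smul_apply, smul_eq_mul, refK_apply, conjW_diag_apply, conjV_diagK_apply,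
      hBff, hRBff, hVff, hff] at hq ⊢
    rw [hq]
    field_simp
    ring
  · -- field–multiplier: the border letter; `Q`, `R₀`, `mmRead N G` vanish
    have hb := hBfm κ u κ' u' x z β m'
    simp only [Pi.add_apply, Pi.neg_apply, Pi.smul_apply, smul_eq_mul, refK_apply, conjW_diag_apply, conjV_diagK_apply,
      mmRead_inr_right, mul_zero, zero_mul, add_zero, zero_add] at hb ⊢
    rw [hb]
    ring
  · have hb := hBmf κ u κ' u' x z m β'
    simp only [Pi.add_apply, Pi.neg_apply, Pi.smul_apply, smul_eq_mul, refK_apply, conjW_diag_apply, conjV_diagK_apply,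
      mmRead_inr_left, mul_zero, zero_mul, add_zero, zero_add] at hb ⊢
    rw [hb]
    ring
  · have hb := hBmm κ u κ' u' x z m m'
    simp only [Pi.add_apply, Pi.neg_apply, Pi.smul_apply, smul_eq_mul, refK_apply, conjW_diag_apply, conjV_diagK_apply,
      mmRead_inr_left, mul_zero, zero_mul, add_zero, zero_add] at hb ⊢
    rw [hb]
    ring

end Step

end

end Summit.QuantumFields.BalabanUV.Beta.SecondOrderStepLaw
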